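import Summits.QuantumAdvantage.AdviceFreeQNC0.WindowBells
import Literature.Computability.MetaComplexity.LinearFormsRegularisation
import Mathlib.Analysis.SpecificLimits.Basic
import HarnessLib

/-!
# Cell qa-qnc0, `p = 3` — GRADED seed expansion (planner qa-qnc0-p1 g38, ROUND-37 §2)

AUTHORED AND PROVED BY THE PLANNER SEAT qa-qnc0-p1 g38 (`HOME/qa-qnc0-p1/exp38/GradedSeeds38.lean`, sha256 c1079ece5a4af769…,
farm rc 0 / 0 sorry / std axioms); landed verbatim by qn-prover-3 g22 (ask P1-38a(1), ROUND-37 §6) as TWO files at the source's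
section boundaries: THIS file = §1 (graded expansion) + §2 (Theorem G `ringGradedSeedsSharp3`); `GradedSeeds38Targets.lean` = §3
(greedy graded seeds, Lemma S) + §4 (typed (J3) targets, `perOutputForms_span`).  Port deltas: lint only (`omit [...] in` ×3, one
unused binder).  Crux stmt-QuantumAdvantage-22907 untouched; no ledger item (D-0168 shelf).

The generic regularise–expand inequality (`LinForms.sum_le_junta_add_twist`, error `p^K · B(w)`) is dead for
`K ~ N` forms.  Replace the single spread threshold by a SEED SEQUENCE `c_0, …, c_{R-1}` whose combinations are
spread GRADED BY THE TOP SEED: every `γ` with top index `j` (`γ_j ≠ 0`, `γ_i = 0` for `i > j`) has a twisted sum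
of norm `≤ B j`.  Then (§1, `sum_le_max_add_graded`)

  `Σ_u G_{c(u)}(u) ≤ max_v Σ_u G_v(u) + Σ_j p^{j+1} · B j`,

and with `B j = A (√3/2)^{8(j+1) + w₀} 2^N` (`twistBoundX3`, PROVED) the error is `O((√3/2)^{w₀}) 2^N` FOR EVERY `R`
(`3 · (√3/2)^8 = 243/256 < 1`).  §2 `ringGradedSeedsSharp3` (UNCONDITIONAL, new): bells = arbitrary per-output tables of
`R` common linear forms mod 3 whose combinations are graded-spread (`#supp ≥ 8(j+1) + w₀(ε)` for top index `j`; e.g.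
`R = N/20` random dense forms, w.h.p.) win on `≤ (2/3 + ε) 2^{N-1}` odd inputs — `R` is NOT bounded by `polylog N`
(compare `ringLinFormsSharp3`: `K ≤ (log₂ N)^C` arbitrary forms).  §3 `exists_gradedSeeds`: every family of forms has a
maximal injective graded-spread seed sequence, and every form is a seed combination plus a remainder of weight `< w R`.
§4 typed targets for the per-output (private) forms programme (J3): the seed–junta class and its conditional law.

WHAT THIS IS NOT: no claim on families whose greedy remainders are heavy (the residual core of (J3)_{r=1}); crux 22907
untouched; nothing here is a ledger item (D-0168 shelf).
-/

noncomputable section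

namespace Summit.QuantumAdvantage.AdviceFreeQNC0

open Finset Literature.Computability.QuantumComplexity Literature.Computability.MetaComplexity

namespace GradedSeeds38

/-! ## §1 The graded expansion inequality (any modulus `p ≥ 1`, abstract seed map) -/

section Graded

variable {p : ℕ} [NeZero p] {R : ℕ} {X : Type*} [Fintype X]

/-- `IsTop γ j`: `j` is the top index of the dual vector `γ`. -/
def IsTop (γ : Fin R → ZMod p) (j : Fin R) : Prop := γ j ≠ 0 ∧ ∀ i, j < i → γ i = 0

/-- `IsTop γ j` is decidable. -/
instance (γ : Fin R → ZMod p) (j : Fin R) : Decidable (IsTop γ j) := by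
  unfold IsTop; infer_instance

omit [NeZero p] in
/-- Every non-zero dual vector has a top index. -/
theorem exists_isTop {γ : Fin R → ZMod p} (h : γ ≠ 0) : ∃ j, IsTop γ j := by
  classical
  have hne : (univ.filter fun j : Fin R => γ j ≠ 0).Nonempty := by
    by_contra h0
    rw [not_nonempty_iff_eq_empty, filter_eq_empty_iff] at h0
    exact h (funext fun j => by simpa using h0 (mem_univ j))
  refine ⟨(univ.filter fun j : Fin R => γ j ≠ 0).max' hne, ?_, fun i hi => ?_⟩
  · exact (mem_filter.1 (max'_mem _ hne)).2
  · by_contra hγi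
    exact absurd (le_max' _ i (mem_filter.2 ⟨mem_univ i, hγi⟩)) (not_le.2 hi)

omit [NeZero p] in
/-- The top index is unique. -/
theorem isTop_unique {γ : Fin R → ZMod p} {j j' : Fin R} (h : IsTop γ j) (h' : IsTop γ j') : j = j' := by
  rcases lt_trichotomy j j' with hlt | heq | hgt
  · exact absurd (h.2 j' hlt) h'.1
  · exact heq
  · exact absurd (h'.2 j hgt) h.1

/-- At most `p^{j+1}` dual vectors vanish above `j`. -/
theorem card_filter_vanish_above_le (j : Fin R) :
    ((univ : Finset (Fin R → ZMod p)).filter fun γ => ∀ i, j < i → γ i = 0).card ≤ p ^ (j.val + 1) := by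
  classical
  have hcard : (univ : Finset (Fin (j.val + 1) → ZMod p)).card = p ^ (j.val + 1) := by
    simp [ZMod.card]
  rw [← hcard]
  refine card_le_card_of_injOn (fun γ => fun i : Fin (j.val + 1) => γ ⟨i.val, by omega⟩)
    (fun _ _ => mem_univ _) ?_
  intro γ hγ γ' hγ' heq
  rw [coe_filter] at hγ hγ'
  funext i
  by_cases hi : j < i
  · rw [hγ.2 i hi, hγ'.2 i hi]
  · have hi' : i.val < j.val + 1 := by
      have : ¬ j.val < i.val := fun h => hi (Fin.lt_def.2 h)
      omega
    have := congrFun heq ⟨i.val, hi'⟩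
    simpa using this

/-- At most `p^{j+1}` dual vectors have top index `j`. -/
theorem card_filter_isTop_le (j : Fin R) :
    ((univ : Finset (Fin R → ZMod p)).filter fun γ => IsTop γ j).card ≤ p ^ (j.val + 1) :=
  (card_le_card (fun _ hγ => mem_filter.2 ⟨mem_univ _, (mem_filter.1 hγ).2.2⟩)).trans
    (card_filter_vanish_above_le j)

/-- **GRADED EXPANSION.**  `c : X → (ℤ/p)^R` any "seed vector" map, `G_v ≥ …` real weights indexed by `v ∈ (ℤ/p)^R`.
If every re-indexed total is `≤ A` and every twisted sum `Σ_u χ_p(⟨γ, c(u)⟩) G_v(u)` with `γ` of top index `j` has norm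
`≤ B j`, then `Σ_u G_{c(u)}(u) ≤ A + Σ_j p^{j+1} B j`.  (Expand `[c(u) = v]` in characters; `γ = 0` gives the average of
the re-indexed totals; the `≤ p^{j+1}` dual vectors of top index `j` give one twisted sum each.) -/
theorem sum_le_max_add_graded (c : X → Fin R → ZMod p) (G : (Fin R → ZMod p) → X → ℝ) (A : ℝ) (B : Fin R → ℝ)
    (hB0 : ∀ j, 0 ≤ B j) (hA : ∀ v, ∑ u, G v u ≤ A)
    (hB : ∀ (v γ : Fin R → ZMod p) (j : Fin R), IsTop γ j →
      ‖∑ u, (ZMod.stdAddChar (∑ i, γ i * c u i) : ℂ) * (G v u : ℂ)‖ ≤ B j) :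
    ∑ u, G (c u) u ≤ A + ∑ j : Fin R, (p : ℝ) ^ (j.val + 1) * B j := by
  classical
  -- the twisted pieces
  obtain ⟨F, hF⟩ : ∃ F : (Fin R → ZMod p) → ℂ, F = fun γ =>
      ∑ v : Fin R → ZMod p, (ZMod.stdAddChar (-∑ i, γ i * v i) : ℂ) *
        ∑ u, (ZMod.stdAddChar (∑ i, γ i * c u i) : ℂ) * (G v u : ℂ) := ⟨_, rfl⟩
  have hpR : (0 : ℝ) < (p : ℝ) ^ R := pow_pos (by exact_mod_cast NeZero.pos p) R
  have hpC : ((p : ℂ) ^ R) ≠ 0 := pow_ne_zero _ (by exact_mod_cast NeZero.ne p)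
  have hcardV : Fintype.card (Fin R → ZMod p) = p ^ R := by simp [ZMod.card]
  -- (1) the expansion identity `Σ_u G_{c u}(u) = p^{-R} Σ_γ F γ`
  have hcell : ∀ u, (G (c u) u : ℂ) = ∑ v, (if c u = v then (1 : ℂ) else 0) * (G v u : ℂ) := by
    intro u
    rw [Fintype.sum_eq_single (c u) (fun v hv => by rw [if_neg (Ne.symm hv), zero_mul]), if_pos rfl, one_mul]
  have hchar : ∀ (γ v : Fin R → ZMod p) (u : X),
      (ZMod.stdAddChar (∑ i, γ i * (c u i - v i)) : ℂ)
        = (ZMod.stdAddChar (-∑ i, γ i * v i) : ℂ) * (ZMod.stdAddChar (∑ i, γ i * c u i) : ℂ) := by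
    intro γ v u
    rw [← AddChar.map_add_eq_mul]
    congr 1
    rw [← sum_neg_distrib, ← sum_add_distrib]
    exact sum_congr rfl fun i _ => by ring
  have hexp : (∑ u, (G (c u) u : ℂ)) = ((p : ℂ) ^ R)⁻¹ * ∑ γ, F γ := by
    calc (∑ u, (G (c u) u : ℂ))
        = ∑ u, ∑ v : Fin R → ZMod p, (((p : ℂ) ^ R)⁻¹ *
            ∑ γ : Fin R → ZMod p, (ZMod.stdAddChar (∑ i, γ i * (c u i - v i)) : ℂ)) * (G v u : ℂ) := by
          refine sum_congr rfl fun u _ => ?_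
          rw [hcell u]
          exact sum_congr rfl fun v _ => by rw [TwoModuli.ite_eq_eq_sum_stdAddChar (c u) v]
      _ = ((p : ℂ) ^ R)⁻¹ * ∑ u, ∑ v : Fin R → ZMod p, ∑ γ : Fin R → ZMod p,
            (ZMod.stdAddChar (-∑ i, γ i * v i) : ℂ) * ((ZMod.stdAddChar (∑ i, γ i * c u i) : ℂ) * (G v u : ℂ)) := by
          rw [mul_sum]
          refine sum_congr rfl fun u _ => ?_
          rw [mul_sum]
          refine sum_congr rfl fun v _ => ?_
          rw [mul_assoc, sum_mul]
          congr 1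
          exact sum_congr rfl fun γ _ => by rw [hchar γ v u, mul_assoc]
      _ = ((p : ℂ) ^ R)⁻¹ * ∑ γ : Fin R → ZMod p, ∑ v : Fin R → ZMod p, ∑ u,
            (ZMod.stdAddChar (-∑ i, γ i * v i) : ℂ) * ((ZMod.stdAddChar (∑ i, γ i * c u i) : ℂ) * (G v u : ℂ)) := by
          congr 1
          rw [sum_congr rfl fun u _ => sum_comm, sum_comm]
          exact sum_congr rfl fun γ _ => sum_comm
      _ = ((p : ℂ) ^ R)⁻¹ * ∑ γ, F γ := by
          congr 1
          refine sum_congr rfl fun γ _ => ?_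
          rw [hF]
          simp only [mul_sum]
  -- (2) the `γ = 0` piece is the sum of the re-indexed totals
  have hF0 : F 0 = ∑ v : Fin R → ZMod p, ∑ u, (G v u : ℂ) := by
    rw [hF]
    simp only [Pi.zero_apply, zero_mul, sum_const_zero, neg_zero, AddChar.map_zero_eq_one, one_mul]
  have hsplit : ∑ γ, F γ = F 0 + ∑ γ ∈ univ.erase 0, F γ := (add_sum_erase univ F (mem_univ 0)).symm
  -- (3) norm of a twisted piece with top index `j`
  have hFle : ∀ γ : Fin R → ZMod p, γ ≠ 0 →
      ‖F γ‖ ≤ (p : ℝ) ^ R * ∑ j : Fin R, (if IsTop γ j then B j else 0) := by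
    intro γ hγ
    obtain ⟨j₀, hj₀⟩ := exists_isTop hγ
    have hterm : ∀ v : Fin R → ZMod p,
        ‖(ZMod.stdAddChar (-∑ i, γ i * v i) : ℂ) * ∑ u, (ZMod.stdAddChar (∑ i, γ i * c u i) : ℂ) * (G v u : ℂ)‖
          ≤ ∑ j : Fin R, (if IsTop γ j then B j else 0) := by
      intro v
      rw [norm_mul, ZMod.stdAddChar_apply, Circle.norm_coe, one_mul]
      refine (hB v γ j₀ hj₀).trans ?_
      have h := single_le_sum (s := univ) (f := fun j : Fin R => if IsTop γ j then B j else 0)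
        (fun j _ => by split_ifs; exacts [hB0 j, le_rfl]) (mem_univ j₀)
      simpa [hj₀] using h
    calc ‖F γ‖ ≤ ∑ v : Fin R → ZMod p,
          ‖(ZMod.stdAddChar (-∑ i, γ i * v i) : ℂ) * ∑ u, (ZMod.stdAddChar (∑ i, γ i * c u i) : ℂ) * (G v u : ℂ)‖ := by
          rw [hF]; exact norm_sum_le _ _
      _ ≤ ∑ v : Fin R → ZMod p, ∑ j : Fin R, (if IsTop γ j then B j else 0) := sum_le_sum fun v _ => hterm v
      _ = (p : ℝ) ^ R * ∑ j : Fin R, (if IsTop γ j then B j else 0) := by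
          rw [sum_const, card_univ, hcardV, nsmul_eq_mul, Nat.cast_pow]
  -- (4) the graded count
  have hcount : ∑ γ ∈ univ.erase (0 : Fin R → ZMod p), ∑ j : Fin R, (if IsTop γ j then B j else 0)
      ≤ ∑ j : Fin R, (p : ℝ) ^ (j.val + 1) * B j := by
    rw [sum_comm]
    refine sum_le_sum fun j _ => ?_
    rw [← sum_filter, sum_const, nsmul_eq_mul]
    have h1 : (((univ.erase (0 : Fin R → ZMod p)).filter fun γ => IsTop γ j).card : ℝ) ≤ (p : ℝ) ^ (j.val + 1) := by
      have h := (card_le_card (filter_subset_filter _ (erase_subset (0 : Fin R → ZMod p) univ))).trans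
        (card_filter_isTop_le (p := p) j)
      exact_mod_cast h
    exact mul_le_mul_of_nonneg_right h1 (hB0 j)
  -- (5) assemble: real parts
  have herr : ‖((p : ℂ) ^ R)⁻¹ * ∑ γ ∈ univ.erase 0, F γ‖ ≤ ∑ j : Fin R, (p : ℝ) ^ (j.val + 1) * B j := by
    rw [norm_mul, norm_inv, norm_pow, Complex.norm_natCast]
    calc ((p : ℝ) ^ R)⁻¹ * ‖∑ γ ∈ univ.erase 0, F γ‖
        ≤ ((p : ℝ) ^ R)⁻¹ * ∑ γ ∈ univ.erase (0 : Fin R → ZMod p),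
            ((p : ℝ) ^ R * ∑ j : Fin R, (if IsTop γ j then B j else 0)) := by
          gcongr
          exact (norm_sum_le _ _).trans (sum_le_sum fun γ hγ => hFle γ (ne_of_mem_erase hγ))
      _ = ∑ γ ∈ univ.erase (0 : Fin R → ZMod p), ∑ j : Fin R, (if IsTop γ j then B j else 0) := by
          rw [← mul_sum, ← mul_assoc, inv_mul_cancel₀ hpR.ne', one_mul]
      _ ≤ ∑ j : Fin R, (p : ℝ) ^ (j.val + 1) * B j := hcount
  have hmain : (((p : ℂ) ^ R)⁻¹ * F 0).re ≤ A := by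
    have e : ((p : ℂ) ^ R)⁻¹ * F 0 = ((((p : ℝ) ^ R)⁻¹ * ∑ v : Fin R → ZMod p, ∑ u, G v u : ℝ) : ℂ) := by
      rw [hF0]; push_cast; rfl
    rw [e, Complex.ofReal_re]
    have hs : ∑ v : Fin R → ZMod p, ∑ u, G v u ≤ (p : ℝ) ^ R * A := by
      have h := sum_le_sum (s := (univ : Finset (Fin R → ZMod p))) fun v _ => hA v
      rw [sum_const, card_univ, hcardV, nsmul_eq_mul, Nat.cast_pow] at h
      exact h
    calc ((p : ℝ) ^ R)⁻¹ * ∑ v : Fin R → ZMod p, ∑ u, G v u ≤ ((p : ℝ) ^ R)⁻¹ * ((p : ℝ) ^ R * A) := by gcongr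
      _ = A := by rw [← mul_assoc, inv_mul_cancel₀ hpR.ne', one_mul]
  have hre : ∑ u, G (c u) u = (((p : ℂ) ^ R)⁻¹ * F 0).re + (((p : ℂ) ^ R)⁻¹ * ∑ γ ∈ univ.erase 0, F γ).re := by
    have h := congrArg Complex.re hexp
    rw [hsplit, mul_add, Complex.add_re] at h
    rw [← h, ← Complex.ofReal_sum, Complex.ofReal_re]
  rw [hre]
  exact add_le_add hmain ((Complex.re_le_norm _).trans herr)

end Graded

/-! ## §2 The ring game at `p = 3`: graded-spread common forms, arbitrarily many (UNCONDITIONAL) -/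

section Ring

/-- **Graded spread** of a seed sequence `c_0, …, c_{R-1}` of linear forms mod 3 on `N` bits: every combination with top
seed `j` has at least `w j` non-zero coefficients. -/
def GradedSpread {N R : ℕ} (c : Fin R → Fin N → ZMod 3) (w : Fin R → ℕ) : Prop :=
  ∀ (γ : Fin R → ZMod 3) (j : Fin R), IsTop γ j → w j ≤ (univ.filter fun m : Fin N => ∑ i, γ i * c i m ≠ 0).card

/-- `(√3/2)^8 = 81/256`. -/
theorem sqrt3_half_pow_eight : (Real.sqrt 3 / 2 : ℝ) ^ 8 = 81 / 256 := by
  have h3 : Real.sqrt 3 ^ 2 = 3 := Real.sq_sqrt (by norm_num)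
  have : (Real.sqrt 3 / 2 : ℝ) ^ 8 = (Real.sqrt 3 ^ 2) ^ 4 / 256 := by ring
  rw [this, h3]; norm_num

/-- The graded error series: `Σ_{j<R} (243/256)^{j+1} ≤ 19` for every `R`. -/
theorem sum_q_pow_le (R : ℕ) : ∑ j : Fin R, (243 / 256 : ℝ) ^ (j.val + 1) ≤ 19 := by
  have h1 : ∑ j : Fin R, (243 / 256 : ℝ) ^ (j.val + 1) = ∑ i ∈ Ico 1 (R + 1), (243 / 256 : ℝ) ^ i := by
    rw [Finset.sum_Ico_eq_sum_range, Fin.sum_univ_eq_sum_range (fun n => (243 / 256 : ℝ) ^ (n + 1)) R]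
    simp only [Nat.add_sub_cancel]
    exact sum_congr rfl fun k _ => by rw [add_comm]
  rw [h1]
  refine (geom_sum_Ico_le_of_lt_one (by norm_num) (by norm_num)).trans ?_
  norm_num

open scoped Classical in
/-- **`ringGradedSeedsSharp3` — PROVED, UNCONDITIONAL (ROUND-37 §2, Theorem G).**  For every `ε > 0` there are `w₀, n₀`
such that for `N ≥ n₀`, EVERY `R` and every seed sequence `c : Fin R → (Fin N → ℤ/3)` with graded spread
`#supp(Σ_i γ_i c_i) ≥ 8(j+1) + w₀` (top index `j`), the strategy whose `k`-th bell is an ARBITRARY table of the `R` residues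
`(⟨c_0,x⟩, …, ⟨c_{R-1},x⟩) mod 3` wins on at most `(2/3 + ε)·2^{N−1}` odd inputs.  `R` is unrestricted (the thresholds force
`R ≤ N/8`); e.g. `R = N/20` random dense forms qualify w.h.p. (min weight of a top-`j` combination ≈ 0.5N ≥ 8j).  Inputs: `twistBoundX3`, `ringWindowBellsSharp3` (tree, proved) and
the graded expansion `sum_le_max_add_graded`. -/
theorem ringGradedSeedsSharp3 : ∀ ε : ℝ, 0 < ε → ∃ w₀ n₀ : ℕ, ∀ N ≥ n₀, ∀ (R : ℕ) (c : Fin R → Fin N → ZMod 3),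
    GradedSpread c (fun j => 8 * (j.val + 1) + w₀) →
    ∀ tab : Fin N → (Fin R → ZMod 3) → Bool,
      ((univ.filter fun x : Fin N → Bool =>
          OddZeros x ∧ RingHLF.Rel x (fun k => xor (tGuess x k) (tab k (LinForms.resVec c x)))).card : ℝ)
        ≤ (2 / 3 + ε) * (2 : ℝ) ^ (N - 1) := by
  classical
  intro ε hε
  obtain ⟨A, hA⟩ := BondTwist3.twistBoundX3
  obtain ⟨L₀, hL₀⟩ := BondTwist3.ringWindowBellsSharp3 (ε / 2) (by linarith)
  -- `m₁` with `|A| · (3/4)^{m₁} ≤ ε/80`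
  obtain ⟨m₁, hm₁⟩ : ∃ m₁ : ℕ, |A| * (3 / 4 : ℝ) ^ m₁ ≤ ε / 80 := by
    obtain ⟨k, hk⟩ := exists_pow_lt_of_lt_one (show 0 < (ε / 80) / (|A| + 1) by positivity)
      (show (3 / 4 : ℝ) < 1 by norm_num)
    refine ⟨k, ?_⟩
    have hA1 : 0 < |A| + 1 := by positivity
    have := (lt_div_iff₀ hA1).1 hk
    nlinarith [abs_nonneg A, pow_nonneg (show (0:ℝ) ≤ 3/4 by norm_num) k]
  refine ⟨2 * m₁, max L₀ 1, fun N hN R c hspread tab => ?_⟩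
  have hNL : L₀ ≤ N := le_trans (le_max_left _ _) hN
  have hN1 : 1 ≤ N := le_trans (le_max_right _ _) hN
  set P : (Fin R → ZMod 3) → (Fin N → Bool) → Prop := fun v x =>
    OddZeros x ∧ RingHLF.Rel x (fun k => xor (tGuess x k) (tab k v)) with hP
  set Bj : Fin R → ℝ := fun j => |A| * (Real.sqrt 3 / 2) ^ (8 * (j.val + 1) + 2 * m₁) * (2 : ℝ) ^ N with hBj
  have hBj0 : ∀ j, 0 ≤ Bj j := fun j => by positivity
  -- (a) main term: constant bells, `ringWindowBellsSharp3` with the whole input as the free window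
  have ha : ∀ v : Fin R → ZMod 3,
      ∑ x : Fin N → Bool, (if P v x then (1 : ℝ) else 0) ≤ (2 / 3 + ε / 2) * (2 : ℝ) ^ (N - 1) := by
    intro v
    set B0 : (Fin N → Bool) → Finset (Fin N) := fun _ => univ.filter fun k => tab k v = true with hB0
    have h := hL₀ N 0 N hNL (by omega) B0 (fun _ _ _ => rfl)
    have hfun : ∀ x : Fin N → Bool, (fun k => xor (tGuess x k) (decide (k ∈ B0 x))) =
        (fun k => xor (tGuess x k) (tab k v)) := by
      intro x; funext k
      simp only [hB0, mem_filter, mem_univ, true_and, Bool.decide_eq_true]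
    simp only [hfun] at h
    rw [sum_boole]
    simpa [hP] using h
  -- (b) graded twisted sums: `twistBoundX3`
  have hb : ∀ (v γ : Fin R → ZMod 3) (j : Fin R), IsTop γ j →
      ‖∑ x : Fin N → Bool, (ZMod.stdAddChar (∑ i, γ i * LinForms.resVec c x i) : ℂ) *
          ((if P v x then (1 : ℝ) else 0 : ℝ) : ℂ)‖ ≤ Bj j := by
    intro v γ j hj
    set β : Fin N → ZMod 3 := fun m => ∑ i, γ i * c i m with hβ
    set B0 : Finset (Fin N) := univ.filter fun k => tab k v = true with hB0
    have hres : ∀ x : Fin N → Bool, ∑ i, γ i * LinForms.resVec c x i = ∑ m, if x m then β m else 0 := by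
      intro x
      simp only [LinForms.resVec, hβ, mul_sum]
      rw [sum_comm]
      refine sum_congr rfl fun m _ => ?_
      split_ifs <;> simp
    have hfun : ∀ x : Fin N → Bool, (fun k => xor (tGuess x k) (decide (k ∈ B0))) =
        (fun k => xor (tGuess x k) (tab k v)) := by
      intro x; funext k
      simp only [hB0, mem_filter, mem_univ, true_and, Bool.decide_eq_true]
    have h := hA N B0 β
    simp only [hfun] at h
    have hcast : ∀ x : Fin N → Bool, (((if P v x then (1 : ℝ) else 0 : ℝ)) : ℂ) = (if P v x then (1 : ℂ) else 0) := by
      intro x; split_ifs <;> simp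
    simp_rw [hres, hcast]
    refine le_trans (by simpa [hP] using h) ?_
    have hs : (0 : ℝ) ≤ Real.sqrt 3 / 2 := by positivity
    have hs1 : Real.sqrt 3 / 2 ≤ 1 := by
      rw [div_le_one (by norm_num)]
      have : Real.sqrt 3 ≤ Real.sqrt 4 := Real.sqrt_le_sqrt (by norm_num)
      have h4 : Real.sqrt 4 = 2 := by
        rw [show (4:ℝ) = 2 ^ 2 by norm_num, Real.sqrt_sq (by norm_num)]
      linarith
    have hw : 8 * (j.val + 1) + 2 * m₁ ≤ (univ.filter fun i => β i ≠ 0).card := hspread γ j hj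
    calc A * (Real.sqrt 3 / 2) ^ (univ.filter fun i => β i ≠ 0).card * (2 : ℝ) ^ N
        ≤ |A| * (Real.sqrt 3 / 2) ^ (univ.filter fun i => β i ≠ 0).card * (2 : ℝ) ^ N := by
          gcongr; exact le_abs_self A
      _ ≤ |A| * (Real.sqrt 3 / 2) ^ (8 * (j.val + 1) + 2 * m₁) * (2 : ℝ) ^ N := by
          gcongr _ * ?_ * _
          exact pow_le_pow_of_le_one hs hs1 hw
  -- the graded expansion
  have hmain := sum_le_max_add_graded (p := 3) (fun x : Fin N → Bool => LinForms.resVec c x)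
    (fun v x => if P v x then (1 : ℝ) else 0) ((2 / 3 + ε / 2) * (2 : ℝ) ^ (N - 1)) Bj hBj0 ha hb
  have hset : ((univ.filter fun x : Fin N → Bool =>
      OddZeros x ∧ RingHLF.Rel x (fun k => xor (tGuess x k) (tab k (LinForms.resVec c x)))).card : ℝ)
      = ∑ x : Fin N → Bool, (if P (LinForms.resVec c x) x then (1 : ℝ) else 0) := by
    rw [sum_boole]
  rw [hset]
  refine hmain.trans ?_
  -- the error term: `Σ_j 3^{j+1} Bj j ≤ (ε/2) 2^{N-1}`
  have herr : ∑ j : Fin R, ((3 : ℕ) : ℝ) ^ (j.val + 1) * Bj j ≤ (ε / 2) * (2 : ℝ) ^ (N - 1) := by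
    have hterm : ∀ j : Fin R, ((3 : ℕ) : ℝ) ^ (j.val + 1) * Bj j =
        (243 / 256 : ℝ) ^ (j.val + 1) * (|A| * (3 / 4 : ℝ) ^ m₁ * (2 : ℝ) ^ N) := by
      intro j
      have h34 : ((Real.sqrt 3 / 2) ^ 2) ^ m₁ = (3 / 4 : ℝ) ^ m₁ := by
        congr 1
        rw [div_pow, Real.sq_sqrt (by norm_num)]; norm_num
      have e1 : (Real.sqrt 3 / 2 : ℝ) ^ (8 * (j.val + 1) + 2 * m₁) = (81 / 256 : ℝ) ^ (j.val + 1) * (3 / 4 : ℝ) ^ m₁ := by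
        rw [pow_add, pow_mul, pow_mul, sqrt3_half_pow_eight, h34]
      have e2 : (243 / 256 : ℝ) ^ (j.val + 1) = (3 : ℝ) ^ (j.val + 1) * (81 / 256 : ℝ) ^ (j.val + 1) := by
        rw [← mul_pow]; norm_num
      have eB : Bj j = |A| * (Real.sqrt 3 / 2) ^ (8 * (j.val + 1) + 2 * m₁) * (2 : ℝ) ^ N := rfl
      rw [eB, e1, e2]; push_cast; ring
    rw [sum_congr rfl fun j _ => hterm j, ← sum_mul]
    have hN2 : (2 : ℝ) ^ N = 2 * (2 : ℝ) ^ (N - 1) := by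
      rw [← pow_succ']; congr 1; omega
    rw [hN2]
    have hq := sum_q_pow_le R
    have hp : (0 : ℝ) ≤ (2 : ℝ) ^ (N - 1) := by positivity
    have hq0 : (0 : ℝ) ≤ ∑ j : Fin R, (243 / 256 : ℝ) ^ (j.val + 1) := sum_nonneg fun j _ => by positivity
    calc (∑ j : Fin R, (243 / 256 : ℝ) ^ (j.val + 1)) * (|A| * (3 / 4 : ℝ) ^ m₁ * (2 * (2 : ℝ) ^ (N - 1)))
        ≤ 19 * ((ε / 80) * (2 * (2 : ℝ) ^ (N - 1))) := by
          refine mul_le_mul hq ?_ (by positivity) (by norm_num)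
          exact mul_le_mul_of_nonneg_right hm₁ (by positivity)
      _ ≤ (ε / 2) * 2 ^ (N - 1) := by nlinarith
  linarith

end Ring

end GradedSeeds38

end Summit.QuantumAdvantage.AdviceFreeQNC0

end
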